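/-
Copyright (c) 2026 the pub-hodgecm-mathlib formalisation cell (harness21).  Prover seat hodgecm-mathlib-LA3-p01 (g0), «GO 500» half A line L3
(socket `stub_FROB`, road ROOF → `stub_ROOF0`), organ #4 «THE LEGS OF A λ-ROOF ARE ISOGENIES»; 2026-09-02.
-/
import Literature.AlgebraicGeometry.AbelianSchemes.IsogenyOfFiniteKernelOnPoints
import Literature.AlgebraicGeometry.AbelianSchemes.PolarizationKernelSubsetKTheta
import Literature.AlgebraicGeometry.AbelianSchemes.SerreTensorRecognitionOfPoints
import Literature.AlgebraicGeometry.AbelianSchemes.AbelianSchemePolarizationBaseChange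
import Literature.AlgebraicGeometry.AbelianSchemes.AbelianSchemeDualIsogenyHom
import Literature.AlgebraicGeometry.AbelianSchemes.AbelianSchemeFixedPowBaseChange   -- ★ `RingAction.baseChange`
import HarnessLib

/-!
# The legs of a `λ`-roof `A_x —q→ B ←c— A_{x″}` are ISOGENIES: `q^*λ_B = n·λ_x` (`n ≠ 0`) makes `Ker q(Ω̄)` finite, (r2) makes `Ker c(Ω̄)` finite, and
# equal relative dimensions make `q`, `c` finite and surjective ([MumfordAV1970] §6 App. 1 & 3, §8 Thm. 1, §19 Thm. 1; [GortzWedhorn2023] 27.176–177)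

Topic `AlgebraicGeometry/AbelianSchemes`, namespace `Literature.AlgebraicGeometry.AbelianSchemes.AbelianSchemeOver`.  THEOREMS ONLY (no definition, no named fact,
no `instance`, no notation, no `sorry`); `Ω = Ω̄`.  Cell `hodgecm-mathlib` (D-0151), F0∕P6 «MOD», «GO 500» line L3 (socket `stub_FROB` of the D-line
`Cruxes/HLiu418/Lines/F0_P6a_DatumOfInputs.lean`), road ROOF → `stub_ROOF0`, organ **#4** of LA3-p01: discharges the `[IsFinite q.left] [Surjective q.left]` inputs of ★
organ #3 `exists_roofLeg_specialFibre` (`RoofLegsSpecialFibre`, p847969) and ★ (ν8)(i) from the LETTER `RoofΩ` ALONE — whose (r1) `Ker q(Ω) = K` does not say `K` is finite —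
through (r3) `q ≫ λ_B ≫ q^∨ = λ_x ≫ [n]` and the finiteness of the kernel of a POLARISATION on geometric points (★ `Polarization.finite_setOf_comp_fibreHom_lam_eq_one′`), then
★ «THE ROOF LEGS ARE ISOGENIES» `roof_legs_isFinite_surjective_of_isOfRelDim` (p846xxx) at two fibres of one abelian scheme.  `--supports stmt-HodgeConjecture-24832`, count-neutral.
HONEST LABEL: HC_CM is proved only modulo the cell's 2 remaining named inputs (hLiu418 24832, h413 24833) until rung 0 closes; this file discharges none of them.

## Mathematics

If `q : A → B` is a homomorphism of abelian varieties over `Ω = Ω̄` and `λ_B : B → B̂`, `λ : A → Â` homomorphisms with `q ≫ λ_B ≫ q^∨ = λ ≫ [n]`, `n ≠ 0`, where `λ` is (the fibre of)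
a POLARISATION, then every `P ∈ Ker q(Ω)` satisfies `λ(P)^n = λ(P^n) = 1`, i.e. `P^n ∈ Ker λ(Ω)` — a FINITE subgroup ([MumfordAV1970] §6 App. 1 with §8: `ker Λ(L) = K(L)` is finite
for `L` ample), of order `d` say — so `P^{n·d} = 1`: the kernel points of `q` are `(n·d)`-torsion, hence finitely many ([MumfordAV1970] §6 App. 3).  With (r2) (`Ker c(Ω)` consists of
`𝔭`-torsion points, `0 ≠ N ∈ 𝔭`, ★ `pow_eq_one_of_forall_mem`) and `dim A_x = dim A_{x″}` (two fibres of one abelian scheme of relative dimension `g`), ★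
`roof_legs_isFinite_surjective_of_isOfRelDim` makes BOTH legs finite and surjective.

## Contents
* §1 (generic, `Ω = Ω̄`, any `A B : AbelianSchemeOver (Spec Ω)`) `pow_eq_one_of_comp_eq_one_of_pullback_eq` (`q(P) = 1 ⟹ P^{n·d} = 1`),
  **`finite_setOf_map_eq_one_of_pullback_polarization`** (`Ker q(Ω)` finite from `q^*λ_B = n·λ`, `λ` the base change of a polarisation to the point).
* §2 (two fibres of `𝒜 → Y` at `x, x″ : Spec Ω → Y′ → Y`) **`roof_legs_isFinite_surjective_of_polarization`** — `Surjective q.left ∧ IsFinite q.left ∧ Surjective c.left ∧ IsFinite c.left`.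

## References
* [MumfordAV1970] D. Mumford, *Abelian Varieties* (1970), §6 Application 1 (p. 60) and Application 3 (pp. 62–64), §8 Thm. 1 (p. 77), §19 Thm. 1 (p. 174).
* [GortzWedhorn2023] U. Görtz, T. Wedhorn, *Algebraic Geometry II* (2023), Prop. 27.176, Cor. 27.177.
* [MumfordFogartyKirwan1994] D. Mumford, J. Fogarty, F. Kirwan, *GIT*, 3rd ed. (1994), Ch. 6 §2 Definition 6.3 (p. 120).
-/

set_option autoImplicit false

noncomputable section

universe u

open CategoryTheory CategoryTheory.Limits AlgebraicGeometry MonoidalCategory CartesianMonoidalCategory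
open scoped MonObj
open Literature.AlgebraicGeometry.Motives (AlgPoints specOver)

namespace Literature.AlgebraicGeometry.AbelianSchemes

namespace AbelianSchemeOver

set_option backward.isDefEq.respectTransparency false

/-! ## §1 `Ker q(Ω)` is finite when `q^*λ_B = n·λ` with `λ` a polarisation (read at a geometric point) -/

section KernelFinite

variable {S : Scheme.{u}} {A₀ : AbelianSchemeOver S} (D₀ : A₀.DualPair) (pol : A₀.Polarization D₀)
  {Ω : Type u} [Field Ω] [IsAlgClosed Ω] (s : Spec (.of Ω) ⟶ S)
  {B : AbelianSchemeOver (Spec (.of Ω))} (DB : B.DualPair)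
  (hDB : Nonempty ((Scheme.Modules.pullback (DualPair.unitHatSlice DB)).obj DB.P ≅ SheafOfModules.unit _))
  (hDs : Nonempty ((Scheme.Modules.pullback (DualPair.unitHatSlice (D₀.baseChange s))).obj (D₀.baseChange s).P ≅ SheafOfModules.unit _))
  (q : (A₀.baseChange s).X ⟶ B.X) [IsMonHom q] (lamB : B.X ⟶ DB.hat.X) [IsMonHom lamB]

include hDB hDs in
omit [IsAlgClosed Ω] in
/-- **A kernel point of `q` is killed by `λ ≫ [n]` when `q ≫ λ_B ≫ q^∨ = λ ≫ [n]`** (`q(P) = 1 ⟹ (P ≫ λ)^n = 1`; homomorphisms preserve `1`).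
[cite: MumfordAV1970, §15 Thm. 1 (p. 143)] -/
theorem comp_lam_pow_eq_one_of_comp_eq_one {n : ℕ}
    (h : q ≫ lamB ≫ DualPair.dualIsogenyOver q (D₀.baseChange s) DB = (pol.baseChange s).lam ≫ (D₀.baseChange s).hat.mulN n)
    (P : specOver Ω Ω ⟶ (A₀.baseChange s).X) (hP : P ≫ q = 1) : (P ≫ (pol.baseChange s).lam) ^ n = 1 := by
  haveI := DualPair.isMonHom_dualIsogenyOver q (D₀.baseChange s) DB hDB hDs
  have h1 : P ≫ q ≫ lamB ≫ DualPair.dualIsogenyOver q (D₀.baseChange s) DB = P ≫ (pol.baseChange s).lam ≫ (D₀.baseChange s).hat.mulN n :=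
    congrArg (fun φ => P ≫ φ) h
  rw [← Category.assoc, hP, MonObj.one_comp, ← Category.assoc, mulN_def, MonObj.comp_pow, Category.comp_id] at h1
  exact h1.symm

include hDB hDs in
/-- **`Ker q(Ω)` IS FINITE when `q^*λ_B = n·λ` (`n ≠ 0`) and `λ` is a polarisation read at the geometric point `s`**: the kernel points of `q` map under `λ_s` into the
`n`-torsion, and `Ker λ_s(Ω)` is finite (★ `Polarization.finite_setOf_comp_fibreHom_lam_eq_one′`), so `Ker q(Ω)` lies in the `(n·d)`-torsion, `d = #Ker λ_s(Ω)` — a finite set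
(★ `finite_setOf_map_eq_one_of_pow_eq_one`). [cite: MumfordAV1970, §6 Application 1 (p. 60) and Application 3 (pp. 62–64), §8 Thm. 1 (p. 77)] -/
theorem finite_setOf_map_eq_one_of_pullback_polarization {n : ℕ} (hn : n ≠ 0)
    (h : q ≫ lamB ≫ DualPair.dualIsogenyOver q (D₀.baseChange s) DB = (pol.baseChange s).lam ≫ (D₀.baseChange s).hat.mulN n) :
    {P : (A₀.baseChange s).toAffine.toAbelianVariety.Points Ω | (AlgPoints.map q P : B.toAffine.toAbelianVariety.Points Ω) = 1}.Finite := by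
  haveI := pol.isMonHom
  haveI : IsMonHom (pol.baseChange s).lam := (pol.baseChange s).isMonHom
  -- the kernel of `λ_s` on `Ω`-points, as a finite subgroup
  let Λ : ((A₀.baseChange s).toAffine.toAbelianVariety.Points Ω) →* ((D₀.baseChange s).hat.toAffine.toAbelianVariety.Points Ω) :=
    { toFun := fun P => P ≫ (pol.baseChange s).lam
      map_one' := MonObj.one_comp _
      map_mul' := fun a b => MonObj.mul_comp a b _ }
  have hKfin : (Λ.ker : Set ((A₀.baseChange s).toAffine.toAbelianVariety.Points Ω)).Finite := by
    have hf := pol.finite_setOf_comp_fibreHom_lam_eq_one' s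
    refine hf.subset fun P hP => ?_
    exact hP
  haveI : Finite Λ.ker := hKfin.to_subtype
  have hd : 0 < Nat.card Λ.ker := Nat.card_pos
  -- every kernel point of `q` is `(n · #Ker λ_s)`-torsion
  refine finite_setOf_map_eq_one_of_pow_eq_one q (n * Nat.card Λ.ker) (Nat.mul_ne_zero hn hd.ne') fun P hP => ?_
  have hPn : P ^ n ∈ Λ.ker := by
    rw [MonoidHom.mem_ker, map_pow]
    exact comp_lam_pow_eq_one_of_comp_eq_one D₀ pol s DB hDB hDs q lamB h P hP
  have hcard : (⟨P ^ n, hPn⟩ : Λ.ker) ^ Nat.card Λ.ker = 1 := pow_card_eq_one'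
  rw [pow_mul]
  exact congrArg Subtype.val hcard

end KernelFinite

/-! ## §2 Both legs of the `λ`-roof between two fibres of one abelian scheme are finite and surjective -/

section Legs

variable {Y Y' : Scheme.{u}} (g : Y' ⟶ Y) {Ω : Type u} [Field Ω] [IsAlgClosed Ω] (x x'' : Spec (.of Ω) ⟶ Y')
  {A : AbelianSchemeOver Y} {gA : ℕ} (hA : A.IsOfRelDim gA) {O : Type*} [CommRing O] (act : A.RingAction O)
  (D : A.DualPair) (pol : A.Polarization D)
  {B : AbelianSchemeOver (Spec (.of Ω))} (DB : B.DualPair)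
  (hDB : Nonempty ((Scheme.Modules.pullback (DualPair.unitHatSlice DB)).obj DB.P ≅ SheafOfModules.unit _))
  (hDx : Nonempty ((Scheme.Modules.pullback (DualPair.unitHatSlice ((D.baseChange g).baseChange x))).obj ((D.baseChange g).baseChange x).P ≅
    SheafOfModules.unit _))
  (q : ((A.baseChange g).baseChange x).X ⟶ B.X) [IsMonHom q] (c : ((A.baseChange g).baseChange x'').X ⟶ B.X) [IsMonHom c]
  (lamB : B.X ⟶ DB.hat.X) [IsMonHom lamB]

include hA hDB hDx in
/-- **THE LEGS OF THE `λ`-ROOF ARE ISOGENIES** (`RoofΩ` ⟹ the inputs of ★ (ν8)(i) ∕ ★ organ #3): for two fibres `A_x`, `A_{x″}` of one abelian scheme of relative dimension `g`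
(after any base change `Y′ → Y`) and a roof `A_x —q→ B ←c— A_{x″}` with (r3)-q `q ≫ λ_B ≫ q^∨ = λ_x ≫ [n]`, `n ≠ 0`, (r2) `c(P) = 1 ⟹ ι(a)(P) = 1 ∀ a ∈ 𝔭` with `0 ≠ N ∈ 𝔭`,
and `c` surjective: `q` and `c` are FINITE and SURJECTIVE. [cite: MumfordAV1970, §19 Thm. 1 (proof, p. 174), §6 Application 3 (pp. 62–64)] [cite: GortzWedhorn2023, Prop. 27.176 and Cor. 27.177] -/
theorem roof_legs_isFinite_surjective_of_polarization {n : ℕ} (hn : n ≠ 0)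
    (hq : q ≫ lamB ≫ DualPair.dualIsogenyOver q ((D.baseChange g).baseChange x) DB =
      ((pol.baseChange g).baseChange x).lam ≫ ((D.baseChange g).baseChange x).hat.mulN n)
    {𝔭 : Ideal O} {N : ℕ} (hN : N ≠ 0) (hN𝔭 : (N : O) ∈ 𝔭)
    (hker : ∀ Pt : ((A.baseChange g).baseChange x'').toAffine.toAbelianVariety.Points Ω,
      (AlgPoints.map c Pt : B.toAffine.toAbelianVariety.Points Ω) = 1 →
        ∀ a ∈ 𝔭, (AlgPoints.map (((act.baseChange g).baseChange x'').i a) Pt : ((A.baseChange g).baseChange x'').toAffine.toAbelianVariety.Points Ω) = 1)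
    (hc : Function.Surjective c.left.base) :
    Surjective q.left ∧ IsFinite q.left ∧ Surjective c.left ∧ IsFinite c.left :=
  roof_legs_isFinite_surjective_of_isOfRelDim ((hA.baseChange g).baseChange x) ((hA.baseChange g).baseChange x'') q c hc
    (finite_setOf_map_eq_one_of_pullback_polarization (D.baseChange g) (pol.baseChange g) x DB hDB hDx q lamB hn hq)
    (finite_setOf_map_eq_one_of_pow_eq_one c N hN fun Pt hPt =>
      pow_eq_one_of_forall_mem ((act.baseChange g).baseChange x'') hN𝔭 Pt (hker Pt hPt))

end Legs

end AbelianSchemeOver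

end Literature.AlgebraicGeometry.AbelianSchemes

end
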